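import Summits.QuantumFields.BalabanUV.Beta.GAN24.SourcePairingLevelOneClosed
import Summits.QuantumFields.BalabanUV.Beta.GAN24.FieldResponseCoarseGradient
import Summits.QuantumFields.BalabanUV.Beta.GAN24.TaylorBlockSum

/-!
# `BalabanUV.Beta.GAN24.TwoLevelPairingTransfer` — binder row G-an2-4 ∕ (CONV-C), the (S) row ∕ (W-γ) one level up, the β-CHAIN (levels ≥ 2), FILE F2c′:
# **THE BORDER SECTOR OF THE SOURCE PAIRING SLOT-SUMMED, AT EVERY LEVEL** — `X_{k+1}[vhSAt ρ](h;n;φ) = (stepScale_k·Lc^{d+1})⁻¹·(Lc^{d+1})⁻¹·Σ'_Y Σ_μ (C_k n)(μ,Y)·(dzφ μ Y·EI_{Lc}(H_k h)(μ,Y))`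
# (in-block root, every `k`; `h` direction-wise summable, `n` bounded, `φ` bounded) — the `(C1′)_k` letters in which the two-level transfer identity (C1) (next file) displays its defect
# (G-an2-4 CRUX TEAM (2), seat `b2b-balaban-gan24-formalise-leaf-06` = the (γ) hand, gen 50, journal W-5 [GAN24LEAF06-G50-W5])

NOT IN PRINT; OUR BOOKKEEPING ([folklore] BY NAME: TODAY's A-6 `FieldResponseCoarseGradient.multResponse_fieldResponse_eq` (the β-link `wVH·C_j(H_{j+1} g) = stepScale·𝒬ᵀ_{Lc}(C_{j+1} g)`),
leaf-02 g61's PART 4a `WilsonSectorGaugeLegUnfolding.tsum_mul_contourSumAdj_of_summable` and leaf-06 g46's `RelInvWardPairing.tsum_mul_contourSumAdj_bdd` (adjointness of `𝒬ᵀ`, summable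
side left ∕ right), (α) `BlockWeightContourCommutation.contourSum_endWeight_mul ∕ contourSum_bondSum_mul`, (ε-Λ) `LambdaSlotWeightsTwoLevel.contourSum_fieldResponse` (`𝒬(H_k m) = stepScale_k⁻¹·m`),
leaf-02 g61's PART 2 `BorderSectorSourcePairingSucc.hasSum_prod_gaugeLeg_e3OfK_vhSAt` (the border sector per slot, every `j`), TODAY's `SourcePairingLevelOneClosed` §2 (slot × bond Fubini);
0 `def`, 0 cited fact, 0 `def … : Prop`, 0 sorry).
HONEST FRAMING (cell contract, verbatim): «discharging `BetaPertH` makes Bałaban's UV stability UNCONDITIONAL — a real constructive-QFT result; it is NOT the continuum limit and NOT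
the Clay problem.»  HONEST DEPENDENCY (verbatim): «continuum YM on T⁴ ⇐ BetaPertH ∧ nine spine estimates (0/9 proved); BetaPertH ⇐ (D1) ∧ (D4) ∧ CAP+tail; G-an2-4 gates asym,
D1 and NE2/3/4.»

WHY (journal PROPOSED-3∕A-7 l.51048, W-5).  The level induction `SourcePairingTowerClosed` evaluates the cubic sector of `X_{j+2}` by `CubicSectorLevelDown.cubicSector_SrecAt_eq_levelDown`
and the induction hypothesis, which delivers the level-`j+1` main terms `T1_j`, `T2_j` AT THE RESPONSES; this file transfers them back up one level (§2 (C1), §3 (C2) — ENGINE E30's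
commutation identities `𝒬(Ψ⁺⊙v) = ψ⁺⊙𝒬v − dψ⊙EI v`, `𝒬(σ_Ψ⊙v) = σ_ψ⊙𝒬v + dψ⊙(BO − EI)v` read through the β-link and adjointness), and slot-sums the border sector (§1) into the same
`(C1′)_{j+1}` letters so that the `(C1′)` cancellation at the pins is one `ring`.
LETTERS (all INLINE; `G = G_{j+1}`, `G′ = G_j`, `G_k = coDressKBmAt ρ_c Lc (KInvStep Lc k)`): `(H m)(a,v) = Σ_μ Σ'_y m μ y·colH G Lc μ y a v`; `(C m)(κ,Y) = Σ_a Σ'_v m a v·colM G Lc a v κ Y`;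
`(C′ m)(κ,Y) = Σ_a Σ'_v m a v·colM G′ Lc a v κ Y`; `T1_k(h;n;φ) = Σ_l Σ'_t h l t·(φ(t+e_l)·(C_k n)(l,t))`; `T2_k(h;n;φ) = Σ'_Y Σ_κ (C_k h)(κ,Y)·((φ Y + φ(Y+e_κ))·n κ Y)`;
`EI ∕ BO` = FILE (α)'s end-inside ∕ base-outside partial contour sums at block side `Lc`.
* §1 `l1_toSite_add_smul_le`, `abs_partialContour_colH_le` (ANY selection of contour positions of a response column decays in FINE units `≤ C·e^{−δ|Y − t|₁}`), `slotSum_partialContour_eq`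
  (the slot sum enters the selected partial contour sum), **`borderSector_slotSum_eq`**: `X_{k+1}[vhSAt ρ](h;n;φ) = (stepScale_k·Lc^{d+1})⁻¹·(Lc^{d+1})⁻¹·Σ'_Y Σ_μ (C_k n)(μ,Y)·(dzφ μ Y·EI(H_k h)(μ,Y))`.
* (C1)∕(C2) themselves are the next file `TwoLevelMainTermsTransfer` (split for the file-length cap).
Asserts NO value of any resolvent column beyond (T1)'s Euler–Lagrange identity and FILE (α); NOTHING of `hX` at `j ≥ 1` ∕ (W-γ)_{≥2} ∕ (INV) ∕ (S) above level 1 discharged;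
NEVER «G-an2-4 closed» as (CONV-C); NOT D1, NOT `BetaPertH`, NOT continuum, NOT Clay.  2026-08-23; no existing file touched.
-/

noncomputable section

open Finset
open scoped BigOperators
open Literature.MathematicalPhysics.QuantumFieldTheory
open Literature.MathematicalPhysics.QuantumFieldTheory.Balaban1983to89
open Literature.MathematicalPhysics.QuantumFieldTheory.Balaban1983to89.Beta
open B12Sec2to5 (l1 l1_nonneg)
open ExpKernelCalculus (Site MKer Decays Zl Zl_nonneg summable_exp_shift' tsum_exp_shift' l1_sub_triangle l1_sub_symm l1_natSmul)
open OneStepResolventKernel (Fib LocStencil)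
open LatticeForm (quo)
open AffineAveraging (Form1 box toSite unitVec unitVec_apply dz contourSum)
open AffineReproduction (contourSumAdj)
open AveragingContours (blk)
open AveragingContoursRooted (ctrOff ctrOff_mem_box)
open AveragingHessianKernelsRooted (vhSAt)
open KernelSpecInstance (wΦ)
open StepJetData (l1_add_le)
open OneStepKernelFamily (KInvStep colH)
open SecondOrderResponse (colM)
open BalabanStepJetsSucc (wVH)
open Summit.QuantumFields.BalabanUV.Beta.AxialDressingRooted (coDressKBmAt decays_coDressKBmAt_KInvStep one_le_of_neZero)
open Summit.QuantumFields.BalabanUV.Beta.BorderedHessian (stepScale stepScale_ne_zero)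
open Summit.QuantumFields.BalabanUV.Beta.SpineRooted (e3OfK)
open Summit.QuantumFields.BalabanUV.Beta.GAN24.MultiplierVertexBondSum (abs_colM_le_fine)
open Summit.QuantumFields.BalabanUV.Beta.GAN24.CoarseGaugeSourceResponse (summable_bdd_mul)
open Summit.QuantumFields.BalabanUV.Beta.GAN24.RelInvWardPairing (tsum_mul_contourSumAdj_bdd)
open Summit.QuantumFields.BalabanUV.Beta.GAN24.WilsonSectorGaugeLegUnfolding (tsum_mul_contourSumAdj_of_summable)
open Summit.QuantumFields.BalabanUV.Beta.GAN24.BlockWeightContourCommutation (contourSum_endWeight_mul contourSum_bondSum_mul)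
open Summit.QuantumFields.BalabanUV.Beta.GAN24.LambdaSlotWeightsTwoLevel (contourSum_fieldResponse)
open Summit.QuantumFields.BalabanUV.Beta.GAN24.TaylorBlockSum (summable_comp_quo)
open Summit.QuantumFields.BalabanUV.Beta.GAN24.CubicPushGaugeLegUnfoldingFF (abs_fieldResponse_le')
open Summit.QuantumFields.BalabanUV.Beta.GAN24.CubicSectorLevelDown (summable_uncurry_mul_decay_mul_bdd summable_fieldResponse)
open Summit.QuantumFields.BalabanUV.Beta.GAN24.FieldResponseCoarseGradient (multResponse_fieldResponse_eq)
open Summit.QuantumFields.BalabanUV.Beta.GAN24.BorderSectorSourcePairingSucc (hasSum_prod_gaugeLeg_e3OfK_vhSAt)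
open Summit.QuantumFields.BalabanUV.Beta.GAN24.SourcePairingLevelOneClosed (abs_multResponse_le slotSum_tsum_sum_mul_eq)
open Summit.QuantumFields.BalabanUV.Beta.GAN24.WilsonSectorGaugeLegUnfolding (colM_coDressKBmAt_KInvStep_swap)

namespace Summit.QuantumFields.BalabanUV.Beta.GAN24.TwoLevelPairingTransfer

variable {d : ℕ} {Lc : ℕ} [NeZero Lc]

/-! ## §1 Decay of the partial contour sums of a response column; the border sector slot-summed -/

omit [NeZero Lc] in
/-- [folklore] An in-block offset plus fewer than `Lc` steps has `ℓ¹`-size at most `(d + 2)·Lc`. -/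
theorem l1_toSite_add_smul_le {b : Fin (d + 1) → ℕ} (hb : b ∈ box (d + 1) Lc) (κ : Fin (d + 1)) {s : ℕ} (hs : s < Lc) :
    l1 (toSite b + (s : ℤ) • (unitVec κ : Site (d + 1))) ≤ ((d : ℝ) + 2) * Lc := by
  have hbi : ∀ i, b i < Lc := fun i => Finset.mem_range.1 (Fintype.mem_piFinset.1 hb i)
  refine (l1_add_le _ _).trans ?_
  have h1 : l1 (toSite b : Site (d + 1)) ≤ ((d : ℝ) + 1) * Lc := by
    unfold B12Sec2to5.l1
    calc ∑ μ, |(((toSite b : Site (d + 1)) μ : ℤ) : ℝ)| ≤ ∑ _μ : Fin (d + 1), (Lc : ℝ) := Finset.sum_le_sum fun μ _ => by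
            simp only [AffineAveraging.toSite]; push_cast; rw [abs_of_nonneg (Nat.cast_nonneg _)]; exact_mod_cast (hbi μ).le
      _ = ((d : ℝ) + 1) * Lc := by rw [Finset.sum_const, Finset.card_univ, Fintype.card_fin, nsmul_eq_mul]; push_cast; ring
  have h2 : l1 ((s : ℤ) • (unitVec κ : Site (d + 1))) ≤ Lc := by
    unfold B12Sec2to5.l1
    have e : ∀ μ : Fin (d + 1), |((((s : ℤ) • (unitVec κ : Site (d + 1))) μ : ℤ) : ℝ)| = if μ = κ then (s : ℝ) else 0 := by
      intro μ; simp only [Pi.smul_apply, unitVec_apply, smul_eq_mul]; split_ifs <;> simp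
    simp only [e, Finset.sum_ite_eq', Finset.mem_univ, if_true]; exact_mod_cast hs.le
  linarith

/-- NOT IN PRINT; OUR BOOKKEEPING.  **EVERY SELECTION OF CONTOUR POSITIONS OF A RESPONSE COLUMN DECAYS IN FINE UNITS** (in-block root, every `j`, any selection `sel κ b s`):
`|Σ_{b∈box} Σ_{s<Lc} [sel κ b s]·colH G_j Lc l t κ (Lc•Y + b + s•e_κ)| ≤ C·e^{−δ|Y − t|₁}` — the column decays from `Lc•t` (`decays_coDressKBmAt_KInvStep`), the contour points are within
`(d+2)·Lc` of `Lc•Y`, and `|Lc•(Y − t)|₁ ≥ |Y − t|₁`. -/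
theorem abs_partialContour_colH_le {r : Fin (d + 1) → ℕ} (hr : r ∈ box (d + 1) Lc) (j : ℕ)
    (sel : Fin (d + 1) → (Fin (d + 1) → ℕ) → ℕ → Prop) [∀ κ b s, Decidable (sel κ b s)] :
    ∃ C δ : ℝ, 0 < δ ∧ 0 ≤ C ∧ ∀ (l : Fin (d + 1)) (t : Site (d + 1)) (κ : Fin (d + 1)) (Y : Site (d + 1)),
      |∑ b ∈ box (d + 1) Lc, ∑ s ∈ Finset.range Lc,
          (if sel κ b s then colH (coDressKBmAt (toSite r) Lc (KInvStep (d := d) Lc j)) Lc l t κ ((Lc : ℤ) • Y + toSite b + (s : ℤ) • unitVec κ) else 0)|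
        ≤ C * Real.exp (-δ * l1 (Y - t)) := by
  classical
  have hLc1 : 1 ≤ Lc := one_le_of_neZero Lc
  obtain ⟨δG, CG, hδG, hCG, hG⟩ := decays_coDressKBmAt_KInvStep (d := d) hr j
  set G := coDressKBmAt (toSite r) Lc (KInvStep (d := d) Lc j) with hGdef
  set K0 : ℝ := ((d : ℝ) + 2) * Lc with hK0
  refine ⟨((box (d + 1) Lc).card : ℝ) * (((Finset.range Lc).card : ℝ) * (CG * Real.exp (δG * K0))), δG, hδG, by positivity, fun l t κ Y => ?_⟩
  -- each contour point
  have hpt : ∀ b ∈ box (d + 1) Lc, ∀ s ∈ Finset.range Lc,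
      |colH G Lc l t κ ((Lc : ℤ) • Y + toSite b + (s : ℤ) • unitVec κ)| ≤ CG * Real.exp (δG * K0) * Real.exp (-δG * l1 (Y - t)) := by
    intro b hb s hs
    have hsL := Finset.mem_range.1 hs
    refine (hG ((Lc : ℤ) • Y + toSite b + (s : ℤ) • unitVec κ) ((Lc : ℤ) • t) (Sum.inl κ) (Sum.inr l)).trans ?_
    rw [mul_assoc, ← Real.exp_add]
    refine mul_le_mul_of_nonneg_left (Real.exp_le_exp.2 ?_) hCG
    have htri := l1_sub_triangle ((Lc : ℤ) • Y) ((Lc : ℤ) • Y + toSite b + (s : ℤ) • unitVec κ) ((Lc : ℤ) • t)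
    have e1 : (Lc : ℤ) • Y - ((Lc : ℤ) • Y + toSite b + (s : ℤ) • unitVec κ) = (0 : Site (d + 1)) - (toSite b + (s : ℤ) • unitVec κ) := by abel
    have e2 : (Lc : ℤ) • Y - (Lc : ℤ) • t = (Lc : ℤ) • (Y - t) := by rw [smul_sub]
    rw [e1, e2, l1_natSmul, l1_sub_symm (0 : Site (d + 1)) (toSite b + (s : ℤ) • unitVec κ), sub_zero] at htri
    have hoff := l1_toSite_add_smul_le (d := d) hb κ hsL
    have hLc' : (1 : ℝ) ≤ Lc := by exact_mod_cast hLc1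
    have hYt := l1_nonneg (Y - t)
    have h3 : l1 (Y - t) ≤ (Lc : ℝ) * l1 (Y - t) := le_mul_of_one_le_left hYt hLc'
    have h4 : l1 (Y - t) - K0 ≤ l1 ((Lc : ℤ) • Y + toSite b + (s : ℤ) • unitVec κ - (Lc : ℤ) • t) := by rw [hK0]; linarith
    have h5 := mul_le_mul_of_nonneg_left h4 hδG.le
    rw [mul_sub] at h5
    rw [neg_mul, neg_mul]
    linarith
  -- sum up
  refine (Finset.abs_sum_le_sum_abs _ _).trans ?_
  calc ∑ b ∈ box (d + 1) Lc, |∑ s ∈ Finset.range Lc, (if sel κ b s then colH G Lc l t κ ((Lc : ℤ) • Y + toSite b + (s : ℤ) • unitVec κ) else 0)|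
      ≤ ∑ _b ∈ box (d + 1) Lc, ((Finset.range Lc).card : ℝ) * (CG * Real.exp (δG * K0) * Real.exp (-δG * l1 (Y - t))) :=
        Finset.sum_le_sum fun b hb => by
          refine (Finset.abs_sum_le_sum_abs _ _).trans ?_
          calc ∑ s ∈ Finset.range Lc, |(if sel κ b s then colH G Lc l t κ ((Lc : ℤ) • Y + toSite b + (s : ℤ) • unitVec κ) else 0)|
              ≤ ∑ _s ∈ Finset.range Lc, CG * Real.exp (δG * K0) * Real.exp (-δG * l1 (Y - t)) := Finset.sum_le_sum fun s hs => by
                split_ifs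
                · exact hpt b hb s hs
                · rw [abs_zero]; positivity
            _ = ((Finset.range Lc).card : ℝ) * (CG * Real.exp (δG * K0) * Real.exp (-δG * l1 (Y - t))) := by rw [Finset.sum_const, nsmul_eq_mul]
    _ = ((box (d + 1) Lc).card : ℝ) * (((Finset.range Lc).card : ℝ) * (CG * Real.exp (δG * K0))) * Real.exp (-δG * l1 (Y - t)) := by
        rw [Finset.sum_const, nsmul_eq_mul]; ring

/-- [folklore] **THE SLOT SUM ENTERS THE SELECTED PARTIAL CONTOUR SUM** (in-block root, every `j`, `h` direction-wise summable, any selection, every `κ`, `Y`):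
`Σ_l Σ'_t h l t·Σ_{b,s}[sel]·colH G_j l t κ (Lc•Y + b + s•e_κ) = Σ_{b,s}[sel]·(H_j h) κ (Lc•Y + b + s•e_κ)`. -/
theorem slotSum_partialContour_eq {r : Fin (d + 1) → ℕ} (hr : r ∈ box (d + 1) Lc) (j : ℕ) {h : Form1 (d + 1) ℝ} (hh : ∀ l, Summable (h l))
    (sel : (Fin (d + 1) → ℕ) → ℕ → Prop) [∀ b s, Decidable (sel b s)] (κ : Fin (d + 1)) (Y : Site (d + 1)) :
    ∑ l, ∑' t : Site (d + 1), h l t * ∑ b ∈ box (d + 1) Lc, ∑ s ∈ Finset.range Lc,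
        (if sel b s then colH (coDressKBmAt (toSite r) Lc (KInvStep (d := d) Lc j)) Lc l t κ ((Lc : ℤ) • Y + toSite b + (s : ℤ) • unitVec κ) else 0)
      = ∑ b ∈ box (d + 1) Lc, ∑ s ∈ Finset.range Lc, (if sel b s then
          (∑ l, ∑' t : Site (d + 1), h l t * colH (coDressKBmAt (toSite r) Lc (KInvStep (d := d) Lc j)) Lc l t κ ((Lc : ℤ) • Y + toSite b + (s : ℤ) • unitVec κ)) else 0) := by
  classical
  obtain ⟨δG, CG, hδG, hCG, hG⟩ := decays_coDressKBmAt_KInvStep (d := d) hr j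
  set G := coDressKBmAt (toSite r) Lc (KInvStep (d := d) Lc j) with hGdef
  -- summability of each slot family
  have hs : ∀ (l : Fin (d + 1)) (u : Site (d + 1)), Summable fun t : Site (d + 1) => h l t * colH G Lc l t κ u := fun l u =>
    (summable_bdd_mul (hh l) (fun t => show |colH G Lc l t κ u| ≤ CG from (hG u ((Lc : ℤ) • t) (Sum.inl κ) (Sum.inr l)).trans
      (mul_le_of_le_one_right hCG (by rw [Real.exp_le_one_iff]; have := l1_nonneg (u - (Lc : ℤ) • t); nlinarith)))).congr fun t => mul_comm _ _
  have hs' : ∀ (l : Fin (d + 1)) (b : Fin (d + 1) → ℕ) (s : ℕ), Summable fun t : Site (d + 1) =>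
      h l t * (if sel b s then colH G Lc l t κ ((Lc : ℤ) • Y + toSite b + (s : ℤ) • unitVec κ) else 0) := by
    intro l b s
    by_cases hbs : sel b s
    · simp only [if_pos hbs]; exact hs l _
    · simp only [if_neg hbs, mul_zero]; exact summable_zero
  -- per direction: push `h l t` inside and exchange `Σ'_t` with the two finite sums
  have e1 : ∀ l, (∑' t : Site (d + 1), h l t * ∑ b ∈ box (d + 1) Lc, ∑ s ∈ Finset.range Lc,
        (if sel b s then colH G Lc l t κ ((Lc : ℤ) • Y + toSite b + (s : ℤ) • unitVec κ) else 0))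
      = ∑ b ∈ box (d + 1) Lc, ∑ s ∈ Finset.range Lc, ∑' t : Site (d + 1),
          h l t * (if sel b s then colH G Lc l t κ ((Lc : ℤ) • Y + toSite b + (s : ℤ) • unitVec κ) else 0) := by
    intro l
    have e : ∀ t : Site (d + 1), h l t * (∑ b ∈ box (d + 1) Lc, ∑ s ∈ Finset.range Lc,
          (if sel b s then colH G Lc l t κ ((Lc : ℤ) • Y + toSite b + (s : ℤ) • unitVec κ) else 0))
        = ∑ b ∈ box (d + 1) Lc, ∑ s ∈ Finset.range Lc, h l t * (if sel b s then colH G Lc l t κ ((Lc : ℤ) • Y + toSite b + (s : ℤ) • unitVec κ) else 0) := by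
      intro t
      rw [Finset.mul_sum]
      exact Finset.sum_congr rfl fun b _ => Finset.mul_sum _ _ _
    rw [tsum_congr e, Summable.tsum_finsetSum (fun b _ => summable_sum fun s _ => hs' l b s)]
    exact Finset.sum_congr rfl fun b _ => Summable.tsum_finsetSum (fun s _ => hs' l b s)
  rw [Finset.sum_congr rfl fun l _ => e1 l, Finset.sum_comm]
  refine Finset.sum_congr rfl fun b _ => ?_
  rw [Finset.sum_comm]
  refine Finset.sum_congr rfl fun s _ => ?_
  by_cases hbs : sel b s
  · simp only [if_pos hbs]
  · simp only [if_neg hbs, mul_zero, tsum_zero, Finset.sum_const_zero]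

/-- NOT IN PRINT; OUR BOOKKEEPING.  **THE BORDER SECTOR OF THE SOURCE PAIRING, SLOT-SUMMED** (in-block root `ρ = toSite r`, every `j`, `h` direction-wise summable, bounded `n`, bounded `φ`;
`X_{j+1}[vhSAt ρ](h;n;φ) := Σ_l Σ'_t h l t·Σ'_{(u,x)} Σ_κκ₂ n κ u·dzφ κ₂ x·e3OfK Lc G_j (vhSAt ρ) l t u x (inl κ)(inl κ₂)`):
`X_{j+1}[vhSAt ρ](h;n;φ) = (stepScale_j·Lc^{d+1})⁻¹·(Lc^{d+1})⁻¹·Σ'_Y Σ_μ (C_j n)(μ,Y)·(dzφ μ Y·EI_{Lc}(H_j h)(μ,Y))` — leaf-02 g61's PART 2 per slot, the exchange symmetry of the multiplier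
column, and the slot × bond Fubini (`abs_partialContour_colH_le` is the decay input). -/
theorem borderSector_slotSum_eq {r : Fin (d + 1) → ℕ} (hr : r ∈ box (d + 1) Lc) (j : ℕ) {h : Form1 (d + 1) ℝ} (hh : ∀ l, Summable (h l))
    {n : Form1 (d + 1) ℝ} {Bn : ℝ} (hn : ∀ κ u, |n κ u| ≤ Bn) {φ : Site (d + 1) → ℝ} {Bφ : ℝ} (hφ : ∀ y, |φ y| ≤ Bφ) :
    ∑ l, ∑' t : Site (d + 1), h l t * ∑' ux : Site (d + 1) × Site (d + 1), ∑ κ, ∑ κ₂, n κ ux.1 * dz φ κ₂ ux.2 *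
        e3OfK Lc (coDressKBmAt (toSite r) Lc (KInvStep (d := d) Lc j)) (fun κ' u' => vhSAt (toSite r) d Lc rfl κ' u') l t ux.1 ux.2 (Sum.inl κ) (Sum.inl κ₂)
      = ((stepScale d Lc j * (Lc : ℝ) ^ (d + 1))⁻¹ * ((Lc : ℝ) ^ (d + 1))⁻¹) *
        ∑' Y : Site (d + 1), ∑ μ : Fin (d + 1),
          (∑ κ₀, ∑' u : Site (d + 1), n κ₀ u * colM (coDressKBmAt (toSite r) Lc (KInvStep (d := d) Lc j)) Lc κ₀ u μ Y)
            * (dz φ μ Y * ∑ b ∈ box (d + 1) Lc, ∑ s ∈ Finset.range Lc, (if b μ + s + 1 < Lc then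
                (∑ l, ∑' t : Site (d + 1), h l t * colH (coDressKBmAt (toSite r) Lc (KInvStep (d := d) Lc j)) Lc l t μ
                  ((Lc : ℤ) • Y + toSite b + (s : ℤ) • unitVec μ)) else 0)) := by
  classical
  -- per slot (PART 2) with the exchange symmetry of the multiplier column
  have hV := fun (l : Fin (d + 1)) (t : Site (d + 1)) => (hasSum_prod_gaugeLeg_e3OfK_vhSAt hr j l t hn hφ).tsum_eq
  have hCn : ∀ (μ : Fin (d + 1)) (Y : Site (d + 1)), (∑ κ, ∑' u : Site (d + 1), n κ u * colM (coDressKBmAt (toSite r) Lc (KInvStep (d := d) Lc j)) Lc μ Y κ u)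
      = ∑ κ₀, ∑' u : Site (d + 1), n κ₀ u * colM (coDressKBmAt (toSite r) Lc (KInvStep (d := d) Lc j)) Lc κ₀ u μ Y :=
    fun μ Y => Finset.sum_congr rfl fun κ _ => tsum_congr fun u => by rw [colM_coDressKBmAt_KInvStep_swap]
  simp only [hV, hCn]
  set G := coDressKBmAt (toSite r) Lc (KInvStep (d := d) Lc j) with hGdef
  set Cn : Fin (d + 1) → Site (d + 1) → ℝ := fun μ Y => ∑ κ₀, ∑' u : Site (d + 1), n κ₀ u * colM G Lc κ₀ u μ Y with hCndef
  set EIc : Fin (d + 1) → Site (d + 1) → Fin (d + 1) → Site (d + 1) → ℝ := fun l t μ Y => ∑ b ∈ box (d + 1) Lc, ∑ s ∈ Finset.range Lc,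
    (if b μ + s + 1 < Lc then colH G Lc l t μ ((Lc : ℤ) • Y + toSite b + (s : ℤ) • unitVec μ) else 0) with hEIc
  set cst : ℝ := (stepScale d Lc j * (Lc : ℝ) ^ (d + 1))⁻¹ * ((Lc : ℝ) ^ (d + 1))⁻¹ with hcst
  -- reorder each per-slot summand and pull the constant out of the slot sum
  have e1 : ∀ (l : Fin (d + 1)) (t : Site (d + 1)), h l t * (cst * ∑' Y : Site (d + 1), ∑ μ : Fin (d + 1), Cn μ Y * (dz φ μ Y * EIc l t μ Y))
      = cst * (h l t * ∑' Y : Site (d + 1), ∑ μ : Fin (d + 1), EIc l t μ Y * (Cn μ Y * dz φ μ Y)) := by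
    intro l t
    rw [show (∑' Y : Site (d + 1), ∑ μ : Fin (d + 1), Cn μ Y * (dz φ μ Y * EIc l t μ Y)) = ∑' Y : Site (d + 1), ∑ μ : Fin (d + 1), EIc l t μ Y * (Cn μ Y * dz φ μ Y)
      from tsum_congr fun Y => Finset.sum_congr rfl fun μ _ => by ring]
    ring
  have e2 : (∑ l, ∑' t : Site (d + 1), h l t * (cst * ∑' Y : Site (d + 1), ∑ μ : Fin (d + 1), Cn μ Y * (dz φ μ Y * EIc l t μ Y)))
      = cst * ∑ l, ∑' t : Site (d + 1), h l t * ∑' Y : Site (d + 1), ∑ μ : Fin (d + 1), EIc l t μ Y * (Cn μ Y * dz φ μ Y) := by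
    simp only [e1, tsum_mul_left, Finset.mul_sum]
  rw [show (stepScale d Lc j * (Lc : ℝ) ^ (d + 1))⁻¹ * ((Lc : ℝ) ^ (d + 1))⁻¹ = cst from rfl] at *
  rw [e2]
  congr 1
  -- the slot × bond Fubini
  obtain ⟨C, δ, hδ, hC, hc⟩ := abs_partialContour_colH_le (d := d) hr j (fun (μ : Fin (d + 1)) (b : Fin (d + 1) → ℕ) (s : ℕ) => b μ + s + 1 < Lc)
  obtain ⟨BC, hBC0, hCb⟩ := abs_multResponse_le (d := d) hr j hn
  have hBφ : 0 ≤ Bφ := (abs_nonneg _).trans (hφ 0)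
  have hw : ∀ (μ : Fin (d + 1)) (Y : Site (d + 1)), |Cn μ Y * dz φ μ Y| ≤ BC * (2 * Bφ) := fun μ Y => by
    rw [abs_mul]; exact mul_le_mul ((hCb μ Y).2) (KKTFluctuationEnergy.abs_dz_le hφ μ Y) (abs_nonneg _) hBC0
  have hc' : ∀ (l : Fin (d + 1)) (t : Site (d + 1)) (μ : Fin (d + 1)) (Y : Site (d + 1)), |EIc l t μ Y| ≤ C * Real.exp (-δ * l1 (Y - t)) :=
    fun l t μ Y => hc l t μ Y
  rw [slotSum_tsum_sum_mul_eq hδ hC hc' hh hw]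
  refine tsum_congr fun Y => Finset.sum_congr rfl fun μ _ => ?_
  rw [show (∑ l, ∑' t : Site (d + 1), h l t * EIc l t μ Y) = ∑ b ∈ box (d + 1) Lc, ∑ s ∈ Finset.range Lc, (if b μ + s + 1 < Lc then
      (∑ l, ∑' t : Site (d + 1), h l t * colH G Lc l t μ ((Lc : ℤ) • Y + toSite b + (s : ℤ) • unitVec μ)) else 0) from
    slotSum_partialContour_eq hr j hh (fun b s => b μ + s + 1 < Lc) μ Y]
  ring

end Summit.QuantumFields.BalabanUV.Beta.GAN24.TwoLevelPairingTransfer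

end
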